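import Mathlib
import HarnessLib

/-!
# The size of `η`-nets in the sphere: `|N| ≤ (4/η)ⁿ` (Matoušek, Lemma 13.1.1)

J. Matoušek, *Lectures on Discrete Geometry* (GTM 212, Springer 2002) [Matousek2002], Chapter 13
"Volumes in High Dimension", §13.1 "Volumes, Paradoxes of High Dimension, and Nets",
pp. 314–315.

The text: a set `N ⊆ S^{n−1}` is *`η`-dense* if every point of `S^{n−1}` is at distance at most
`η` from some point of `N`, and *`η`-separated* if every two distinct points of `N` have distance
greater than `η`; one builds a small `η`-dense set greedily, keeping the current set
`η`-separated — "clearly, if no more points can be added, the current set must be `η`-dense"; an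
inclusion-maximal `η`-separated subset is called an *`η`-net*. **Lemma 13.1.1** (Size of `η`-nets
in the sphere): *For each `η ∈ (0,1]`, any `η`-net `N ⊆ S^{n−1}` satisfies `|N| ≤ (4/η)ⁿ`.*
Printed proof: the balls of radius `η/2` centred at the points of `N` are disjoint and contained
in `B(0, 1+η) ⊆ B(0, 2)`; hence `vol B(0,2) ≥ |N|·vol B(0, η/2)`, and `vol B(0, r) ∝ rⁿ`.

Setting: `E` a finite-dimensional real normed space, `n = dim E` (the volume argument works for
any norm); the volume is Mathlib's additive Haar measure `Measure.addHaar`, and the computation is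
the one of Mathlib's special case `Besicovitch.card_le_of_separated` (radius `2`, `1`-separated,
bound `5ⁿ`), which we follow line by line with general radii. Separation is taken in the weak form
`‖c − d‖ ≥ η` (implied by the book's `> η`), and the bound only uses separation, not maximality.

PROVED here (theorems only, no definitions, no named facts):
* **`card_mul_pow_le_of_separated`** — `‖c‖ ≤ R` on `s`, `s` `η`-separated ⇒
  `|s|·(η/2)ⁿ ≤ (R + η/2)ⁿ` (the volume comparison);
* `card_le_of_separated` — hence `|s| ≤ (1 + 2R/η)ⁿ`;
* **`card_le_of_separated_unitBall`** — Lemma 13.1.1: in the unit ball (in particular on the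
  sphere), `η ≤ 2` ⇒ `|s| ≤ (4/η)ⁿ`;
* **`exists_net`** — the greedy construction: for `A ⊆ B̄(0,1)` and `η > 0` there is a finite
  `η`-separated `N ⊆ A` which is `η`-dense in `A`, with `|N| ≤ (1 + 2/η)ⁿ`; `exists_net_sphere` —
  with the bound `(4/η)ⁿ` for `η ≤ 2`;
* the same in Mathlib's covering-number vocabulary (`Metric.packingNumber`, `Metric.coveringNumber`,
  `Metric.IsCover`, `Metric.IsSeparated`): `packingNumber_le`, `coveringNumber_sphere_le`,
  `exists_isCover_sphere`.

## References

* [Matousek2002] J. Matoušek, *Lectures on Discrete Geometry*, GTM 212, Springer (2002), §13.1,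
  Lemma 13.1.1 and the preceding paragraph, pp. 314–315 (held text
  `galaxy-panama-431008558088267`, chunks 304–305).
-/

namespace Literature.Geometry.DiscreteGeometry.SphereNets

open Metric MeasureTheory Module Set
open scoped ENNReal NNReal

variable {E : Type*} [NormedAddCommGroup E] [NormedSpace ℝ E] [FiniteDimensional ℝ E]

/-! ### The volume argument -/

open scoped Function in
/-- **The volume comparison.** If the points of `s` have norm `≤ R` and are `η`-separated
(`‖c − d‖ ≥ η` for `c ≠ d`), then the disjoint balls `B(c, η/2)`, `c ∈ s`, lie in `B(0, R + η/2)`,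
so `|s|·(η/2)ⁿ ≤ (R + η/2)ⁿ`, `n = dim E`. [cite: Matousek2002, §13.1, proof of Lemma 13.1.1
(p. 315)] -/
theorem card_mul_pow_le_of_separated (s : Finset E) {R η : ℝ} (hR : 0 ≤ R) (hη : 0 < η)
    (hs : ∀ c ∈ s, ‖c‖ ≤ R) (h : ∀ c ∈ s, ∀ d ∈ s, c ≠ d → η ≤ ‖c - d‖) :
    (s.card : ℝ) * (η / 2) ^ finrank ℝ E ≤ (R + η / 2) ^ finrank ℝ E := by
  borelize E
  let μ : Measure E := Measure.addHaar
  set δ : ℝ := η / 2 with hδ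
  set ρ : ℝ := R + η / 2 with hρ
  have δpos : 0 < δ := by positivity
  have ρpos : 0 < ρ := by positivity
  set A := ⋃ c ∈ s, ball (c : E) δ with hA
  have D : Set.Pairwise (s : Set E) (Disjoint on fun c => ball (c : E) δ) := by
    rintro c hc d hd hcd
    apply ball_disjoint_ball
    rw [dist_eq_norm]
    have := h c hc d hd hcd
    linarith
  have A_subset : A ⊆ ball (0 : E) ρ := by
    refine iUnion₂_subset fun x hx => ?_
    apply ball_subset_ball'
    rw [dist_zero_right]
    linarith [hs x hx]
  have I : (s.card : ℝ≥0∞) * ENNReal.ofReal (δ ^ finrank ℝ E) * μ (ball 0 1) ≤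
      ENNReal.ofReal (ρ ^ finrank ℝ E) * μ (ball 0 1) :=
    calc (s.card : ℝ≥0∞) * ENNReal.ofReal (δ ^ finrank ℝ E) * μ (ball 0 1) = μ A := by
          rw [hA, measure_biUnion_finset D fun c _ => measurableSet_ball]
          simp only [μ.addHaar_ball_of_pos _ δpos]
          simp only [Finset.sum_const, nsmul_eq_mul, mul_assoc]
      _ ≤ μ (ball (0 : E) ρ) := measure_mono A_subset
      _ = ENNReal.ofReal (ρ ^ finrank ℝ E) * μ (ball 0 1) := by
          simp only [μ.addHaar_ball_of_pos _ ρpos]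
  have J : (s.card : ℝ≥0∞) * ENNReal.ofReal (δ ^ finrank ℝ E) ≤ ENNReal.ofReal (ρ ^ finrank ℝ E) :=
    (ENNReal.mul_le_mul_iff_left (measure_ball_pos _ _ zero_lt_one).ne' measure_ball_lt_top.ne).1 I
  have K := ENNReal.toReal_le_of_le_ofReal (pow_nonneg ρpos.le _) J
  rw [ENNReal.toReal_mul, ENNReal.toReal_natCast, ENNReal.toReal_ofReal (pow_nonneg δpos.le _)] at K
  exact K

/-- **Separated sets in a ball are small**: `‖c‖ ≤ R` on `s` and `s` `η`-separated ⇒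
`|s| ≤ (1 + 2R/η)ⁿ`. [cite: Matousek2002, §13.1, proof of Lemma 13.1.1 (p. 315)] -/
theorem card_le_of_separated (s : Finset E) {R η : ℝ} (hR : 0 ≤ R) (hη : 0 < η)
    (hs : ∀ c ∈ s, ‖c‖ ≤ R) (h : ∀ c ∈ s, ∀ d ∈ s, c ≠ d → η ≤ ‖c - d‖) :
    (s.card : ℝ) ≤ (1 + 2 * R / η) ^ finrank ℝ E := by
  have key := card_mul_pow_le_of_separated s hR hη hs h
  have hpow : (0 : ℝ) < (η / 2) ^ finrank ℝ E := by positivity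
  rw [← le_div_iff₀ hpow, ← div_pow] at key
  have hne : η ≠ 0 := hη.ne'
  have e : (R + η / 2) / (η / 2) = 1 + 2 * R / η := by
    rw [div_eq_iff (by positivity)]
    field_simp
    ring
  rwa [e] at key

/-- **Lemma 13.1.1 (Size of `η`-nets in the sphere).** For `0 < η ≤ 2`, any `η`-separated subset
of the closed unit ball — in particular any `η`-net `N ⊆ S^{n−1}` — has at most `(4/η)ⁿ` points.
(The book states it for `η ∈ (0,1]`; the volume argument gives `(1 + 2/η)ⁿ ≤ (4/η)ⁿ` as soon as
`η ≤ 2`.) [cite: Matousek2002, §13.1, Lemma 13.1.1, p. 315] -/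
theorem card_le_of_separated_unitBall (s : Finset E) {η : ℝ} (hη : 0 < η) (hη2 : η ≤ 2)
    (hs : ∀ c ∈ s, ‖c‖ ≤ 1) (h : ∀ c ∈ s, ∀ d ∈ s, c ≠ d → η ≤ ‖c - d‖) :
    (s.card : ℝ) ≤ (4 / η) ^ finrank ℝ E := by
  refine (card_le_of_separated s zero_le_one hη hs h).trans (pow_le_pow_left₀ (by positivity) ?_ _)
  rw [mul_one, ← sub_nonneg]
  have : 4 / η - (1 + 2 / η) = (2 - η) / η := by field_simp; ring
  rw [this]
  positivity

/-- The same for a subset of the unit sphere `S^{n−1}`, verbatim as printed.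
[cite: Matousek2002, §13.1, Lemma 13.1.1, p. 315] -/
theorem card_le_of_separated_sphere (s : Finset E) {η : ℝ} (hη : 0 < η) (hη2 : η ≤ 2)
    (hs : ∀ c ∈ s, c ∈ sphere (0 : E) 1) (h : ∀ c ∈ s, ∀ d ∈ s, c ≠ d → η < dist c d) :
    (s.card : ℝ) ≤ (4 / η) ^ finrank ℝ E :=
  card_le_of_separated_unitBall s hη hη2 (fun c hc => (mem_sphere_zero_iff_norm.mp (hs c hc)).le)
    fun c hc d hd hcd => by rw [← dist_eq_norm]; exact (h c hc d hd hcd).le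

/-! ### Existence of small nets (the greedy construction) -/

/-- **`η`-nets exist and are small.** For any `A` inside the closed unit ball and `η > 0` there is
a finite `N ⊆ A` which is `η`-separated (distinct points at distance `> η`) and `η`-dense in `A`
(every point of `A` is within `η` of `N`) with `|N| ≤ (1 + 2/η)ⁿ`: an `η`-separated subset of `A`
of maximum cardinality (which exists by the volume bound) cannot be enlarged, hence is dense —
"if no more points can be added, the current set must be `η`-dense". [cite: Matousek2002, §13.1,
paragraph before Lemma 13.1.1 (greedy construction of `η`-nets) and Lemma 13.1.1, pp. 314–315] -/
theorem exists_net {A : Set E} (hA : A ⊆ closedBall (0 : E) 1) {η : ℝ} (hη : 0 < η) :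
    ∃ N : Finset E, ↑N ⊆ A ∧ (∀ x ∈ N, ∀ y ∈ N, x ≠ y → η < dist x y) ∧
      (∀ a ∈ A, ∃ x ∈ N, dist a x ≤ η) ∧ (N.card : ℝ) ≤ (1 + 2 / η) ^ finrank ℝ E := by
  classical
  set B := ⌊(1 + 2 / η) ^ finrank ℝ E⌋₊ with hB
  -- `P m`: there is an `η`-separated `m`-subset of `A`
  let P : ℕ → Prop := fun m =>
    ∃ N : Finset E, ↑N ⊆ A ∧ (∀ x ∈ N, ∀ y ∈ N, x ≠ y → η < dist x y) ∧ N.card = m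
  have hbound : ∀ m, P m → m ≤ B := by
    rintro m ⟨N, hNA, hsep, rfl⟩
    refine Nat.le_floor ?_
    have h1 : (N.card : ℝ) ≤ (1 + 2 * 1 / η) ^ finrank ℝ E :=
      card_le_of_separated N zero_le_one hη
        (fun c hc => mem_closedBall_zero_iff.mp (hA (hNA hc)))
        (fun c hc d hd hcd => by rw [← dist_eq_norm]; exact (hsep c hc d hd hcd).le)
    simpa using h1
  have hP0 : P 0 := ⟨∅, by simp, by simp, rfl⟩
  obtain ⟨N, hNA, hsep, hcard⟩ : P (Nat.findGreatest P B) :=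
    Nat.findGreatest_spec (Nat.zero_le B) hP0
  refine ⟨N, hNA, hsep, ?_, ?_⟩
  · intro a ha
    by_contra! hfar
    have haN : a ∉ N := by
      intro haN'
      have := hfar a haN'
      rw [dist_self] at this
      exact lt_irrefl _ (this.trans hη)
    have hP : P (Nat.findGreatest P B + 1) := by
      refine ⟨insert a N, ?_, ?_, by rw [Finset.card_insert_of_notMem haN, hcard]⟩
      · rw [Finset.coe_insert]
        exact Set.insert_subset ha hNA
      · intro x hx y hy hxy
        rw [Finset.mem_insert] at hx hy
        rcases hx with rfl | hx <;> rcases hy with rfl | hy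
        · exact absurd rfl hxy
        · exact hfar y hy
        · rw [dist_comm]; exact hfar x hx
        · exact hsep x hx y hy hxy
    exact Nat.findGreatest_is_greatest (Nat.lt_succ_self _) (hbound _ hP) hP
  · calc (N.card : ℝ) = Nat.findGreatest P B := by rw [hcard]
      _ ≤ B := by exact_mod_cast Nat.findGreatest_le B
      _ ≤ (1 + 2 / η) ^ finrank ℝ E := Nat.floor_le (by positivity)

/-- **Small `η`-nets of the sphere**: for `0 < η ≤ 2` there is an `η`-net `N ⊆ S^{n−1}`
(`η`-separated and `η`-dense) with `|N| ≤ (4/η)ⁿ`. [cite: Matousek2002, §13.1, Lemma 13.1.1 and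
the preceding paragraph, pp. 314–315] -/
theorem exists_net_sphere {η : ℝ} (hη : 0 < η) (hη2 : η ≤ 2) :
    ∃ N : Finset E, (∀ x ∈ N, x ∈ sphere (0 : E) 1) ∧ (∀ x ∈ N, ∀ y ∈ N, x ≠ y → η < dist x y) ∧
      (∀ a ∈ sphere (0 : E) 1, ∃ x ∈ N, dist a x ≤ η) ∧ (N.card : ℝ) ≤ (4 / η) ^ finrank ℝ E := by
  obtain ⟨N, hNS, hsep, hdense, -⟩ :=
    exists_net (sphere_subset_closedBall (x := (0 : E)) (ε := 1)) hη
  exact ⟨N, fun x hx => hNS hx, hsep, hdense,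
    card_le_of_separated_sphere N hη hη2 (fun x hx => hNS hx) hsep⟩

/-! ### In Mathlib's covering-number vocabulary -/

/-- **Packing numbers of subsets of the unit ball**: for `η > 0` and `A ⊆ B̄(0,1)`,
`packingNumber η A ≤ ⌊(1 + 2/η)ⁿ⌋` — every `η`-separated subset of `A` is finite with at most that
many points. [cite: Matousek2002, §13.1, Lemma 13.1.1 (volume argument), p. 315] -/
theorem packingNumber_le {η : ℝ≥0} (hη : 0 < η) {A : Set E} (hA : A ⊆ closedBall (0 : E) 1) :
    Metric.packingNumber η A ≤ (⌊(1 + 2 / (η : ℝ)) ^ finrank ℝ E⌋₊ : ℕ) := by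
  classical
  set B := ⌊(1 + 2 / (η : ℝ)) ^ finrank ℝ E⌋₊ with hB
  unfold Metric.packingNumber
  refine iSup₂_le fun C hCA => iSup_le fun hsep => ?_
  have key : ∀ s : Finset E, ↑s ⊆ C → s.card ≤ B := by
    intro s hsC
    refine Nat.le_floor ?_
    have h1 : (s.card : ℝ) ≤ (1 + 2 * 1 / (η : ℝ)) ^ finrank ℝ E := by
      refine card_le_of_separated s zero_le_one (by exact_mod_cast hη)
        (fun c hc => mem_closedBall_zero_iff.mp (hA (hCA (hsC hc)))) fun c hc d hd hcd => ?_
      have hlt : (η : ℝ≥0∞) < edist c d := hsep (hsC hc) (hsC hd) hcd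
      rw [edist_dist, ← ENNReal.ofReal_coe_nnreal,
        ENNReal.ofReal_lt_ofReal_iff (dist_pos.mpr hcd), dist_eq_norm] at hlt
      exact hlt.le
    simpa using h1
  have hfin : C.Finite := by
    by_contra hinf
    obtain ⟨s, hsC, hcard⟩ := Set.Infinite.exists_subset_card_eq hinf (B + 1)
    have := key s hsC
    omega
  rw [Set.Finite.encard_eq_coe_toFinset_card hfin]
  exact_mod_cast key hfin.toFinset (by simp)

/-- **Packing number of the sphere**: for `0 < η ≤ 2`, `packingNumber η S^{n−1} ≤ ⌊(4/η)ⁿ⌋`.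
[cite: Matousek2002, §13.1, Lemma 13.1.1, p. 315] -/
theorem packingNumber_sphere_le {η : ℝ≥0} (hη : 0 < η) (hη2 : η ≤ 2) :
    Metric.packingNumber η (sphere (0 : E) 1) ≤ (⌊(4 / (η : ℝ)) ^ finrank ℝ E⌋₊ : ℕ) := by
  refine (packingNumber_le hη sphere_subset_closedBall).trans ?_
  have hη' : (0 : ℝ) < η := by exact_mod_cast hη
  have hη2' : (η : ℝ) ≤ 2 := by exact_mod_cast hη2
  have hle : (1 + 2 / (η : ℝ)) ^ finrank ℝ E ≤ (4 / (η : ℝ)) ^ finrank ℝ E := by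
    refine pow_le_pow_left₀ (by positivity) ?_ _
    rw [← sub_nonneg]
    have : 4 / (η : ℝ) - (1 + 2 / η) = (2 - η) / η := by field_simp; ring
    rw [this]
    positivity
  exact_mod_cast Nat.floor_mono hle

/-- **Covering number of the sphere**: for `0 < η ≤ 2`, `S^{n−1}` is covered by at most `⌊(4/η)ⁿ⌋`
closed `η`-balls centred on the sphere (an `η`-net is `η`-dense). [cite: Matousek2002, §13.1,
Lemma 13.1.1 and the preceding paragraph, pp. 314–315] -/
theorem coveringNumber_sphere_le {η : ℝ≥0} (hη : 0 < η) (hη2 : η ≤ 2) :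
    Metric.coveringNumber η (sphere (0 : E) 1) ≤ (⌊(4 / (η : ℝ)) ^ finrank ℝ E⌋₊ : ℕ) :=
  (Metric.coveringNumber_le_packingNumber η _).trans (packingNumber_sphere_le hη hη2)

/-- **An `η`-net of the sphere in Mathlib's terms**: for `0 < η ≤ 2`, Mathlib's maximal
`η`-separated subset of `S^{n−1}` is an `η`-separated `η`-cover of the sphere with at most
`⌊(4/η)ⁿ⌋` points. [cite: Matousek2002, §13.1, Lemma 13.1.1 and the preceding paragraph,
pp. 314–315] -/
theorem exists_isCover_sphere {η : ℝ≥0} (hη : 0 < η) (hη2 : η ≤ 2) :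
    ∃ N ⊆ sphere (0 : E) 1, Metric.IsSeparated η N ∧ Metric.IsCover η (sphere (0 : E) 1) N ∧
      N.encard ≤ (⌊(4 / (η : ℝ)) ^ finrank ℝ E⌋₊ : ℕ) := by
  have hle := packingNumber_sphere_le (E := E) hη hη2
  have hfin : Metric.packingNumber η (sphere (0 : E) 1) ≠ ⊤ :=
    ne_top_of_le_ne_top (ENat.coe_ne_top _) hle
  refine ⟨Metric.maximalSeparatedSet η _, Metric.maximalSeparatedSet_subset,
    Metric.isSeparated_maximalSeparatedSet, Metric.isCover_maximalSeparatedSet hfin, ?_⟩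
  rw [Metric.encard_maximalSeparatedSet hfin]
  exact hle

end Literature.Geometry.DiscreteGeometry.SphereNets
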